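import Summits.KontsevichZagierPeriods.KontsevichZagierPeriods.Theorems.LinRedNormalFormArrangementNormalFormStubRebaseSimpleZeroNestedCommon
import Summits.KontsevichZagierPeriods.KontsevichZagierPeriods.Theorems.LinRedNormalFormArrangementNormalFormStubRebaseSimpleZeroNestedBlowUp

/-!
# Stub `stub_rebaseSimpleZeroTwo`, part `rebaseSimpleZero_nestedCommon` (crux `ArrangementNormalForm`,
line `janus-bands`) — assembly `NestedFinal`

The blow-up hypothesis `RebaseNest.BlowUp` of the nested common-slope dissection HOLDS
(`RebaseNest.blowUp_holds`): if some letter sits at the vertex level `t₀` it is the landed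
pinch-vertex blow-up move `rebaseSimpleZero_nestedBlowUp` (worker W4); if no letter sits at `t₀`,
cut the two-row cell `{0 < ε₁ (y − y₀) < ε}` once more at an explicit `ε' < ε` (rule 1a): the
near piece is `IsNest.good_pinch_free` (sub-section Janus at `t₀`, cone estimate; the base pole is
at `y₀`, the letters keep an explicit distance from `(t₀, B)`), the far piece is thick
(`IsNest.good_thick`). Hence the UNCONDITIONAL part theorem `rebaseSimpleZero_nestedCommonMain`:
nested pairs with letters of a common `y`-slope (literal `GS 0 2` datum) are good for `GG 0 2 2`.

References: M. Kontsevich, D. Zagier, *Periods* (2001), §1.2, rules (1a), (2).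
-/

noncomputable section

open Set MeasureTheory MvPolynomial
open Literature.NumberTheory.Transcendental Literature.ModelTheory.ExponentialFields

namespace Summit.KontsevichZagierPeriods.ArrangementNormalForm.JanusBands

namespace RebaseNest

open SeparatePos RebasePos RebaseZero

/-- **Room above the vertex level.** For constant letters `a` and a level `t₀` there are
rationals `θ, η > 0` such that every letter different from `t₀` keeps the distance `η` from the
interval `(t₀, t₀ + θ)`. [folklore] -/
theorem exists_room (a : Fin 2 → Option Cf) (t₀ : ℚ) : ∃ θ η : ℚ, 0 < θ ∧ 0 < η ∧
    ∀ l c, a l = some c → c.2 ≠ t₀ → ∀ t : ℝ, (t₀ : ℝ) < t → t < t₀ + θ → (η : ℝ) ≤ |t - c.2| := by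
  classical
  obtain ⟨θ, hθ, hθle⟩ := exists_pos_le_forall
    (fun l => (a l).elim 1 fun c => if t₀ < c.2 then (c.2 - t₀) / 2 else 1) fun l => by
      rcases a l with _ | c
      · exact one_pos
      · simp only [Option.elim_some]
        split_ifs with h
        · linarith
        · exact one_pos
  have hθ2 : ∀ l c, a l = some c → t₀ < c.2 → 2 * θ ≤ c.2 - t₀ := fun l c hc hlt => by
    have := hθle l
    simp only [hc, Option.elim_some, if_pos hlt] at this
    linarith
  obtain ⟨η₀, hη₀, hη₀le⟩ := exists_pos_le_forall
    (fun l => (a l).elim 1 fun c => if c.2 < t₀ then t₀ - c.2 else 1) fun l => by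
      rcases a l with _ | c
      · exact one_pos
      · simp only [Option.elim_some]
        split_ifs with h
        · linarith
        · exact one_pos
  have hηb : ∀ l c, a l = some c → c.2 < t₀ → η₀ ≤ t₀ - c.2 := fun l c hc hlt => by
    have := hη₀le l
    simp only [hc, Option.elim_some, if_pos hlt] at this
    exact this
  refine ⟨θ, min θ η₀, hθ, lt_min hθ hη₀, fun l c hc hne t ht1 ht2 => ?_⟩
  rcases lt_or_gt_of_ne hne with hlt | hgt
  · have h1 : ((min θ η₀ : ℚ) : ℝ) ≤ η₀ := by exact_mod_cast min_le_right θ η₀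
    have h2 : (η₀ : ℝ) ≤ t₀ - c.2 := by exact_mod_cast hηb l c hc hlt
    have h3 : (c.2 : ℝ) < t₀ := by exact_mod_cast hlt
    rw [abs_of_pos (by linarith)]
    linarith
  · have h1 : ((min θ η₀ : ℚ) : ℝ) ≤ θ := by exact_mod_cast min_le_left θ η₀
    have h2 : 2 * (θ : ℝ) ≤ c.2 - t₀ := by exact_mod_cast hθ2 l c hc hgt
    have h3 : (t₀ : ℝ) < c.2 := by exact_mod_cast hgt
    rw [abs_of_neg (by linarith)]
    linarith

/-- **The blow-up hypothesis holds.** With a letter at the vertex level it is the landed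
pinch-vertex blow-up move `rebaseSimpleZero_nestedBlowUp` (worker W4); without, one more cut of
the two-row cell at an explicit `ε' < ε` gives a near piece handled by `IsNest.good_pinch_free`
and a thick far piece. [Kontsevich–Zagier 2001, §1.2, rules (1), (2)] -/
theorem blowUp_holds : BlowUp := by
  intro m s L e p ℓ₁ ℓ₂ n₁ n₂ a lo hi i j A Bd y₀ t₀ ε ε₁ hij hloi hhii hloj hhij h1 hn hε hε₁ hℓ₂ hA0 hB0 hα hαβ
    ha0 _ hbd hdom hint
  have hε2 : (ε₁ : ℝ) * ε₁ = 1 := by rcases hε₁ with rfl | rfl <;> norm_num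
  by_cases hpin : ∃ l c, a l = some c ∧ c.2 = t₀
  · -- a pole through the vertex: the blow-up move
    have hA : (A.1 (Fin.last 0) : ℝ) * y₀ + A.2 = t₀ := by
      have h := congrArg (fun q : ℚ => (q : ℝ)) hA0
      simp only [Rat.cast_add, Rat.cast_mul] at h
      exact h
    have hB : (Bd.1 (Fin.last 0) : ℝ) * y₀ + Bd.2 = t₀ := by
      have h := congrArg (fun q : ℚ => (q : ℝ)) hB0
      simp only [Rat.cast_add, Rat.cast_mul] at h
      exact h
    refine rebaseSimpleZero_nestedBlowUp m 2 n₁ n₂ s _ L e p ℓ₁ ℓ₂ a lo hi h1 hn hbd hdom hint i j hij A Bd hloi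
      hhii hloj hhij y₀ t₀ (A.1 (Fin.last 0)) (Bd.1 (Fin.last 0)) ε ε₁ hε₁ hε ?_ (fun z => ?_) (fun z => ?_)
      (fun z => ?_) hℓ₂ ha0 hpin
    · rcases hε₁ with rfl | rfl
      · rw [one_mul] at hα; rw [one_mul, one_mul] at hαβ
        exact Or.inl ⟨hα.le, (hα.trans hαβ).le⟩
      · rw [neg_one_mul] at hα; rw [neg_one_mul, neg_one_mul] at hαβ
        exact Or.inr ⟨by linarith, by linarith⟩
    · exact (rows_iff _ z).trans (mem_cell_two y₀ ε ε₁ _)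
    · rw [affF_eq, ev]
      change (A.1 (Fin.last 0) : ℝ) * yv z + A.2 = t₀ + A.1 (Fin.last 0) * (yv z - y₀)
      linear_combination hA
    · rw [affF_eq, ev]
      change (Bd.1 (Fin.last 0) : ℝ) * yv z + Bd.2 = t₀ + Bd.1 (Fin.last 0) * (yv z - y₀)
      linear_combination hB
  -- no pole through the vertex
  push Not at hpin
  obtain ⟨hlo, hhi⟩ := eq_nlo_nhi hij hloi hhii hloj hhij
  subst hlo hhi
  have hN : IsNest s ![RebaseZero.mk ε₁ (-(ε₁ * y₀)), RebaseZero.mk (-ε₁) (ε₁ * y₀ + ε)] i j A Bd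
      ⟨m, L, e, ℓ₁, ℓ₂, n₁, n₂⟩ p a := ⟨hij, hdom, hint, h1, hn, ha0, hbd⟩
  obtain ⟨θ, η, hθ, hη, hfar⟩ := exists_room a t₀
  set β' : ℚ := ε₁ * Bd.1 (Fin.last 0) with hβ'
  have hβ : 0 < β' := hα.trans hαβ
  set ε' : ℚ := min (ε / 2) (θ / β') with hε'def
  have hε' : 0 < ε' := lt_min (half_pos hε) (div_pos hθ hβ)
  have hε'ε : ε' < ε := (min_le_left _ _).trans_lt (half_lt_self hε)
  have hβε : β' * ε' ≤ θ := by
    have : ε' ≤ θ / β' := min_le_right _ _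
    rwa [le_div_iff₀ hβ, mul_comm] at this
  have hq : RebaseZero.mk (-ε₁) (ε₁ * y₀ + ε') ≠ 0 :=
    mk_ne_zero (by rcases hε₁ with rfl | rfl <;> norm_num) _
  refine hN.rowSplit (RebaseZero.mk (-ε₁) (ε₁ * y₀ + ε')) hq (fun s₁ hN₁ => ?_) (fun s₂ hN₂ => ?_)
  · -- the near piece `ε₁ (y − y₀) < ε'`: sub-section Janus at `t₀`
    have hcell : ∀ y ∈ cell (Fin.snoc ![RebaseZero.mk ε₁ (-(ε₁ * y₀)), RebaseZero.mk (-ε₁) (ε₁ * y₀ + ε)]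
        (RebaseZero.mk (-ε₁) (ε₁ * y₀ + ε')) : Fin (2 + 1) → Cf),
        0 < (ε₁ : ℝ) * (y - y₀) ∧ (ε₁ : ℝ) * (y - y₀) < ε' := fun y hy => by
      rw [mem_cell_snoc, mem_cell_two, ev_mk] at hy
      obtain ⟨⟨h1', -⟩, h3⟩ := hy
      push_cast at h3
      exact ⟨h1', by linarith⟩
    refine hN₁.good_pinch_free y₀ t₀ ε₁ ε' η hε₁ hA0 hB0 hα hαβ.le hcell (fun y _ => ?_) hη
      fun l c hc y hy t ht1 ht2 => hfar l c hc (hpin l c hc) t ht1 ?_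
    · change |y - (y₀ : ℝ)| ≤ |y - (ℓ₂.2 : ℝ)|
      rw [hℓ₂]
    · obtain ⟨h1', h2⟩ := hcell y hy
      obtain ⟨eB, habs⟩ := ev_vertex hε₁ hB0 h1'
      have hβε' : (ε₁ : ℝ) * Bd.1 (Fin.last 0) * ε' ≤ θ := by
        have := hβε; rw [hβ'] at this; exact_mod_cast this
      have hβ0 : (0 : ℝ) < ε₁ * Bd.1 (Fin.last 0) := by have := hβ; rw [hβ'] at this; exact_mod_cast this
      rw [eB, habs] at ht2
      nlinarith
  · -- the far piece `ε' < ε₁ (y − y₀)`: thick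
    refine hN₂.good_thick ((ε₁ * Bd.1 (Fin.last 0) - ε₁ * A.1 (Fin.last 0)) * ε')
      (mul_pos (sub_pos.2 hαβ) hε') fun y hy => ?_
    rw [mem_cell_snoc, mem_cell_two, ev_neg, ev_mk] at hy
    obtain ⟨⟨h1', -⟩, h3⟩ := hy
    push_cast at h3
    have hY : (ε' : ℝ) ≤ ε₁ * (y - y₀) := by linarith
    have hD : ev Bd y - ev A y = ((ε₁ : ℝ) * Bd.1 (Fin.last 0) - ε₁ * A.1 (Fin.last 0)) * (ε₁ * (y - y₀)) := by
      rw [ev_sub_vertex hA0 hB0 y]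
      linear_combination (-((Bd.1 (Fin.last 0) : ℝ) - A.1 (Fin.last 0)) * (y - y₀)) * hε2
    have hpos : (0 : ℝ) < ε₁ * Bd.1 (Fin.last 0) - ε₁ * A.1 (Fin.last 0) := by
      have := sub_pos.2 hαβ; exact_mod_cast this
    rw [hD, Rat.cast_mul, Rat.cast_sub, Rat.cast_mul, Rat.cast_mul]
    exact mul_le_mul_of_nonneg_left hY hpos.le

end RebaseNest

/-- **Registered part `rebaseSimpleZero_nestedCommon` of `stub_rebaseSimpleZeroTwo`, UNCONDITIONAL
form (line `janus-bands`): nested pairs with letters of a common `y`-slope.** A representation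
with the literal `GS 0 2` datum (one base coordinate `y` in a bounded rational cell, base factor
`p/∏ Lⱼ^{eⱼ} · (y − ℓ₁)^{n₁}/(y − ℓ₂)^{n₂}` with `n₂ = 1`, two fibres `tᵢ` with optional letters
`1/(tᵢ − cᵢ(y))`) in which some bound of one fibre is the other fibre (`hnest`) and whose letters
have a COMMON `y`-slope (`hlam`) is congruent modulo `KZ.relations` to a `ℤ`-combination of
elements of the rebased literal class `SeparatePos.GGset 0 2 2` (constant letters, bounds constant
or exactly `y`): `rebaseSimpleZero_nestedCommon` with its blow-up hypothesis discharged by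
`RebaseNest.blowUp_holds` (the landed pinch-vertex blow-up move `rebaseSimpleZero_nestedBlowUp`).
[Kontsevich–Zagier 2001, §1.2, rules (1), (2)] -/
theorem rebaseSimpleZero_nestedCommonMain (m m' n₁ n₂ : ℕ) (s : KZ.IntegralRep (0 + 1 + 2)) (M : Fin m' → (Fin (0 + 1) → ℚ) × ℚ) (L : Fin m → (Fin 0 → ℚ) × ℚ) (e : Fin m → ℕ) (p : MvPolynomial (Fin 0) ℚ) (ℓ₁ ℓ₂ : (Fin 0 → ℚ) × ℚ) (a : Fin 2 → Option ((Fin (0 + 1) → ℚ) × ℚ)) (lo hi : Fin 2 → Fin 2 ⊕ ((Fin (0 + 1) → ℚ) × ℚ)) (h12 : n₁ = 0 ∨ n₂ = 0) (hn : n₂ = 1) (hbd : Bornology.IsBounded s.domain) (hdom : s.domain = {z | (∀ j, 0 < ∑ i, ((M j).1 i : ℝ) * z (Fin.castAdd 2 i) + ((M j).2 : ℝ)) ∧ ∀ i, Sum.elim (fun j => z (Fin.natAdd (0 + 1) j)) (fun c => ∑ i', (c.1 i' : ℝ) * z (Fin.castAdd 2 i') + (c.2 : ℝ)) (lo i) <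 z (Fin.natAdd (0 + 1) i) ∧ z (Fin.natAdd (0 + 1) i) < Sum.elim (fun j => z (Fin.natAdd (0 + 1) j)) (fun c => ∑ i', (c.1 i' : ℝ) * z (Fin.castAdd 2 i') + (c.2 : ℝ)) (hi i)}) (hint : EqOn s.integrand (fun z => MvPolynomial.aeval (fun i => z (Fin.castAdd 2 (Fin.castSucc i))) p / (∏ j, (∑ i, ((L j).1 i : ℝ) * z (Fin.castAdd 2 (Fin.castSucc i)) + ((L j).2 : ℝ)) ^ e j) * ((z (Fin.castAdd 2 (Fin.last 0)) - (∑ i, (ℓ₁.1 i : ℝ) * z (Fin.castAdd 2 (Fin.castSucc i)) + (ℓ₁.2 : ℝ))) ^ n₁ / (z (Fin.castAdd 2 (Fin.last 0)) - (∑ i, (ℓ₂.1 i : ℝ) * z (Fin.castAdd 2 (Fin.castSucc i)) + (ℓ₂.2 : ℝ))) ^ n₂) * ∏ i, (a i).elim 1 (fun c => 1 / (z (Fin.natAdd (0 + 1) i) - (∑ i', (c.1 i' : ℝ) * z (Fin.castAdd 2 i') + (c.2 : ℝ))))) s.domain) (hnest : ∃ i j : Fin 2, i ≠ j ∧ (hi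 i = Sum.inl j ∨ lo j = Sum.inl i)) (hlam : ∃ lam : ℚ, ∀ i c, a i = some c → c.1 (Fin.last 0) = lam) : ∃ c ∈ AddSubgroup.closure (SeparatePos.GGset 0 2 2), KZ.of s - c ∈ KZ.relations :=
  RebaseNest.good_nestedCommon RebaseNest.blowUp_holds s M L e p ℓ₁ ℓ₂ a lo hi h12 hn hbd hdom hint hnest hlam

end Summit.KontsevichZagierPeriods.ArrangementNormalForm.JanusBands
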